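import Mathlib
import HarnessLib

/-!
# Seed crux `SignedMuSeedAtTwoPlus` (stmt-BirchSwinnertonDyer-21438), line `norm-field-tilt`:
# stub S3 `TiltThreshold` and the `ℕ`-glue of stub S2 as kernel theorems

Cell `bsd-wall`, width seat `bsd-wall-rtt-p4-w2` g10; companion of
`…SignedMuSeedAtTwoPlusTiltRecursion.lean` (stub S2: the invariant derivation in characteristic `2`, the Taylor bound
and the CLAIM `v(S_{m+1}) = 2·v(S_m) + 4^{m+1}`).  Parent crux `SignedMuVanishingAtTwoPlus` (stmt-20689), line `birth`
v4.9, whose stub `stub_residualSeedAtTwo` IS the seed item 21438.  HONEST FRAMING: THEOREMS ONLY; elementary; closes no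
item; the seed line `norm-field-tilt` (crux-ideate k2 g12) is NOT registered; BSD is NOT proved by any of this.

## What is proved

**`ℕ`-glue of S2** (the valuations `a m = v(S_m)` as an abstract sequence; the recursion is only assumed where the
non-degeneracy `a m + 2 < 4^{m+1}` holds, exactly as the CLAIM of S2 delivers it):
* `tiltRecursion_nonDeg_and_closedForm` — `NonDeg(m₀)` propagates to every `m ≥ m₀`, and the closed form
  `a (m₀+j) + 2^{2m₀+j+1} = 2·4^{m₀+j} + 2^j·a m₀` (the card's `v(S_m) = 2·4^m − 2^{m+m₀+1} + 2^{m−m₀} v(S_{m₀})`,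
  subtraction-free);
* `tiltRecursion_threshold` — for every `m ≥ m₀ + 2`, `a m + 2^{m+2} < 3·4^m`, i.e. the hypothesis
  `v(S_m) < 3·4^m − 2^{m+2}` of S3 (two levels after the first non-degenerate one; `m₀ + 1` is not enough:
  calibration class `m₀ = 1`, `v(S_2) = 40 ≥ 32`, `v(S_3) = 144 < 160`).

**Stub S3 `TiltThreshold`** over an arbitrary commutative ring `k` of characteristic `2` (NO perfectness needed in the
direction the line uses): if `e` is even and `Z ≡ P(s) (mod X^e)` for a polynomial `P` all of whose odd-degree
coefficients vanish ("only even `s̄`-digits"), then `X^e ∣ Z'` (`X_pow_dvd_derivative_of_forall_odd_coeff`; because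
`P' = 0`, `polynomial_derivative_eq_zero_of_forall_odd_coeff`, and `(X^e W)' = X^e W'`), hence `e ≤ ord Z'`
(`le_order_derivative_of_forall_odd_coeff`); contrapositive = `OddDigit`: `ord Z' < e ⟹ ∃ i odd, P.coeff i ≠ 0`
(`exists_odd_coeff_ne_zero_of_order_derivative_lt`), and in `D log` currency over a domain — `Z·S = u·Z'` and
`ord Z + ord S < e` ⟹ `OddDigit` (`exists_odd_coeff_ne_zero_of_order_add_order_lt`; the card's
`v(S_m) < 3·4^m − 2^{m+2} = e − v(Z'_ρ)`).

Not here: the membership `Z'_{ρ,m} ∈ 𝔽₄[s̄] + (t̄^e)` and `v(Z'_ρ) = 2^{m+2}` (stub S1, local CM theory), the hard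
stub S4.  [folklore]
-/

noncomputable section

set_option autoImplicit false
set_option linter.dupNamespace false

open PowerSeries

namespace Summit.BirchSwinnertonDyer.BirchSwinnertonDyer.Theorems.SignedMuAtTwo.Tilt

/-! ## `ℕ`-glue: propagation of non-degeneracy, closed form, threshold -/

/-- **Non-degeneracy propagates; closed form.**  If `a (m+1) = 2·a m + 4^{m+1}` whenever `m ≥ m₀` and
`a m + 2 < 4^{m+1}` (the CLAIM of S2), and `a m₀ + 2 < 4^{m₀+1}` (`NonDeg(m₀)`), then for every `j`:
`NonDeg(m₀ + j)` and `a (m₀+j) + 2^{2m₀+j+1} = 2·4^{m₀+j} + 2^j·a m₀`. [folklore] -/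
theorem tiltRecursion_nonDeg_and_closedForm (a : ℕ → ℕ) (m₀ : ℕ)
    (hrec : ∀ m, m₀ ≤ m → a m + 2 < 4 ^ (m + 1) → a (m + 1) = 2 * a m + 4 ^ (m + 1))
    (h₀ : a m₀ + 2 < 4 ^ (m₀ + 1)) (j : ℕ) :
    a (m₀ + j) + 2 < 4 ^ (m₀ + j + 1) ∧
      a (m₀ + j) + 2 ^ (2 * m₀ + j + 1) = 2 * 4 ^ (m₀ + j) + 2 ^ j * a m₀ := by
  induction j with
  | zero =>
    refine ⟨by simpa using h₀, ?_⟩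
    have e : (2 : ℕ) ^ (2 * m₀ + 0 + 1) = 2 * 4 ^ (m₀ + 0) := by
      rw [add_zero, add_zero, pow_succ, pow_mul, show (2 : ℕ) ^ 2 = 4 by norm_num, mul_comm]
    rw [e, pow_zero, one_mul]
    simp only [add_zero]
    omega
  | succ j ih =>
    obtain ⟨hnd, hcf⟩ := ih
    have hstep : a (m₀ + (j + 1)) = 2 * a (m₀ + j) + 4 ^ (m₀ + j + 1) := by
      rw [← add_assoc]
      exact hrec (m₀ + j) (Nat.le_add_right _ _) hnd
    have e1 : (4 : ℕ) ^ (m₀ + (j + 1) + 1) = 4 * (4 * 4 ^ (m₀ + j)) := by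
      rw [← add_assoc, pow_succ, pow_succ]; ring
    have e2 : (4 : ℕ) ^ (m₀ + j + 1) = 4 * 4 ^ (m₀ + j) := by rw [pow_succ]; ring
    have e3 : (2 : ℕ) ^ (2 * m₀ + (j + 1) + 1) = 2 * 2 ^ (2 * m₀ + j + 1) := by
      rw [show 2 * m₀ + (j + 1) + 1 = (2 * m₀ + j + 1) + 1 by ring, pow_succ]; ring
    have e4 : (2 : ℕ) ^ (j + 1) * a m₀ = 2 * (2 ^ j * a m₀) := by rw [pow_succ]; ring
    have e5 : (4 : ℕ) ^ (m₀ + (j + 1)) = 4 * 4 ^ (m₀ + j) := by rw [← add_assoc, pow_succ]; ring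
    refine ⟨?_, ?_⟩
    · rw [hstep, e1, e2]; omega
    · rw [hstep, e3, e4, e5, e2]; omega

/-- **Threshold for S3.**  Under the same hypotheses, `a m + 2^{m+2} < 3·4^m` for every `m ≥ m₀ + 2`
(stated as `m = m₀ + 2 + j`).  The quantity `b_m = 3·4^m − 2^{m+2} − a m` obeys `b_{m+1} = 2 b_m + 2·4^m`, and
`b_{m₀+2} > 0` because `a (m₀+2) = 4 a m₀ + 2·4^{m₀+1} + 4^{m₀+2}` and `2Q² − 4Q + 3 > 0` (`Q = 2^{m₀}`). [folklore] -/
theorem tiltRecursion_threshold (a : ℕ → ℕ) (m₀ : ℕ)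
    (hrec : ∀ m, m₀ ≤ m → a m + 2 < 4 ^ (m + 1) → a (m + 1) = 2 * a m + 4 ^ (m + 1))
    (h₀ : a m₀ + 2 < 4 ^ (m₀ + 1)) (j : ℕ) :
    a (m₀ + 2 + j) + 2 ^ (m₀ + 2 + j + 2) < 3 * 4 ^ (m₀ + 2 + j) := by
  induction j with
  | zero =>
    have hnd1 := (tiltRecursion_nonDeg_and_closedForm a m₀ hrec h₀ 1).1
    have hs1 : a (m₀ + 1) = 2 * a m₀ + 4 ^ (m₀ + 1) := hrec m₀ le_rfl h₀
    have hs2 : a (m₀ + 2) = 2 * a (m₀ + 1) + 4 ^ (m₀ + 1 + 1) := hrec (m₀ + 1) (Nat.le_succ _) hnd1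
    have eQ : (4 : ℕ) ^ m₀ = 2 ^ m₀ * 2 ^ m₀ := by
      rw [← mul_pow]; norm_num
    have e1 : (4 : ℕ) ^ (m₀ + 1) = 4 * (2 ^ m₀ * 2 ^ m₀) := by rw [pow_succ, eQ]; ring
    have e2 : (4 : ℕ) ^ (m₀ + 1 + 1) = 16 * (2 ^ m₀ * 2 ^ m₀) := by rw [pow_succ, pow_succ, eQ]; ring
    have e4 : (2 : ℕ) ^ (m₀ + 2 + 2) = 16 * 2 ^ m₀ := by rw [add_assoc, pow_add]; norm_num; ring
    have h₀' := h₀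
    rw [e1] at h₀'
    simp only [add_zero]
    rw [hs2, hs1, e1, e2, e4]
    -- `16·Q < 8·Q² + 12` for `Q = 2^{m₀} ≥ 1` (`2Q² − 4Q + 3 > 0`)
    have key : 16 * 2 ^ m₀ < 8 * (2 ^ m₀ * 2 ^ m₀) + 12 := by
      rcases Nat.lt_or_ge (2 ^ m₀) 2 with h | h
      · have hQ : 1 ≤ 2 ^ m₀ := Nat.one_le_two_pow
        interval_cases (2 ^ m₀); norm_num
      · nlinarith
    omega
  | succ j ih =>
    have hnd := (tiltRecursion_nonDeg_and_closedForm a m₀ hrec h₀ (2 + j)).1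
    rw [← add_assoc] at hnd
    have hstep : a (m₀ + 2 + (j + 1)) = 2 * a (m₀ + 2 + j) + 4 ^ (m₀ + 2 + j + 1) := by
      rw [← add_assoc]
      exact hrec (m₀ + 2 + j) (by omega) hnd
    have e1 : (4 : ℕ) ^ (m₀ + 2 + j + 1) = 4 * 4 ^ (m₀ + 2 + j) := by rw [pow_succ]; ring
    have e2 : (4 : ℕ) ^ (m₀ + 2 + (j + 1)) = 4 * 4 ^ (m₀ + 2 + j) := by rw [← add_assoc, pow_succ]; ring
    have e3 : (2 : ℕ) ^ (m₀ + 2 + (j + 1) + 2) = 2 * 2 ^ (m₀ + 2 + j + 2) := by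
      rw [show m₀ + 2 + (j + 1) + 2 = (m₀ + 2 + j + 2) + 1 by ring, pow_succ]; ring
    rw [hstep, e1, e2, e3]
    omega

/-! ## Stub S3 `TiltThreshold`: even digits ⟹ `X^e ∣ Z'` -/

variable {k : Type*} [CommRing k]

section CharTwo

variable [CharP k 2]

/-- In characteristic `2`, a polynomial all of whose odd-degree coefficients vanish has zero derivative
(`(c X^{2i})' = 2i·c·X^{2i−1} = 0`). [folklore] -/
theorem polynomial_derivative_eq_zero_of_forall_odd_coeff {P : Polynomial k}
    (hP : ∀ i, Odd i → P.coeff i = 0) : Polynomial.derivative P = 0 := by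
  ext i
  rw [Polynomial.coeff_derivative, Polynomial.coeff_zero]
  rcases Nat.even_or_odd (i + 1) with h | h
  · have h2 : ((i : k) + 1) = 0 := by exact_mod_cast (CharP.cast_eq_zero_iff k 2 (i + 1)).mpr h.two_dvd
    rw [h2, mul_zero]
  · rw [hP _ h, zero_mul]

/-- An even natural number is `0` in a power-series ring of characteristic `2`. [folklore] -/
theorem natCast_eq_zero_of_even {e : ℕ} (he : Even e) : (e : PowerSeries k) = 0 := by
  rw [← map_natCast (C (R := k)) e, (CharP.cast_eq_zero_iff k 2 e).mpr he.two_dvd, map_zero]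

/-- **Stub S3 `TiltThreshold`, divisibility form.**  `k` of characteristic `2`, `e` even, `P ∈ k[X]` with all
odd-degree coefficients zero ("only even `s̄`-digits"), `Z ≡ P(s) (mod X^e)` ⟹ `X^e ∣ Z'`.
Proof: `Z = P(s) + X^e W`, `(P(s))' = P'(s)·s' = 0`, `(X^e W)' = e X^{e−1} W + X^e W' = X^e W'`. [folklore] -/
theorem X_pow_dvd_derivative_of_forall_odd_coeff {Z s : PowerSeries k} {P : Polynomial k} {e : ℕ}
    (he : Even e) (hP : ∀ i, Odd i → P.coeff i = 0)
    (hZ : (X : PowerSeries k) ^ e ∣ Z - Polynomial.aeval s P) : (X : PowerSeries k) ^ e ∣ d⁄dX k Z := by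
  obtain ⟨W, hW⟩ := hZ
  have hZ' : Z = Polynomial.aeval s P + X ^ e * W := by rw [← hW]; ring
  have hder : d⁄dX k Z = X ^ e * d⁄dX k W := by
    rw [hZ', map_add, Derivation.comp_aeval_eq, polynomial_derivative_eq_zero_of_forall_odd_coeff hP,
      map_zero, zero_smul, zero_add, Derivation.leibniz, derivative_pow k, derivative_X,
      natCast_eq_zero_of_even he]
    simp
  exact ⟨_, hder⟩

/-- **Stub S3, order form.**  Same hypotheses ⟹ `e ≤ ord Z'`. [folklore] -/
theorem le_order_derivative_of_forall_odd_coeff {Z s : PowerSeries k} {P : Polynomial k} {e : ℕ}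
    (he : Even e) (hP : ∀ i, Odd i → P.coeff i = 0)
    (hZ : (X : PowerSeries k) ^ e ∣ Z - Polynomial.aeval s P) : (e : ℕ∞) ≤ (d⁄dX k Z).order :=
  nat_le_order _ _ (X_pow_dvd_iff.mp (X_pow_dvd_derivative_of_forall_odd_coeff he hP hZ))

/-- **Stub S3, `OddDigit` form (contrapositive).**  `e` even, `Z ≡ P(s) (mod X^e)` and `ord Z' < e` ⟹ some
odd-degree coefficient of `P` (an odd `s̄`-digit of `Z`) is non-zero. [folklore] -/
theorem exists_odd_coeff_ne_zero_of_order_derivative_lt {Z s : PowerSeries k} {P : Polynomial k} {e : ℕ}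
    (he : Even e) (hZ : (X : PowerSeries k) ^ e ∣ Z - Polynomial.aeval s P)
    (hlt : (d⁄dX k Z).order < e) : ∃ i, Odd i ∧ P.coeff i ≠ 0 := by
  by_contra h
  push Not at h
  exact absurd (le_order_derivative_of_forall_odd_coeff he h hZ) (not_le.mpr hlt)

/-- **Stub S3 in `D log` currency** (as the line card states it: `v(S_m) < e − v(Z') ⟹ OddDigit(m)`).
Over a domain of characteristic `2`: `Z·S = u·Z'` (`S = D log Z`, `D = u d/dt`), `e` even, `Z ≡ P(s) (mod X^e)`,
`ord Z + ord S < e` ⟹ some odd-degree coefficient of `P` is non-zero.  (`ord Z' ≤ ord u + ord Z' = ord Z + ord S`.)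
[folklore] -/
theorem exists_odd_coeff_ne_zero_of_order_add_order_lt [NoZeroDivisors k] {u Z S s : PowerSeries k}
    {P : Polynomial k} {e : ℕ} (he : Even e) (hZS : Z * S = u * d⁄dX k Z)
    (hZ : (X : PowerSeries k) ^ e ∣ Z - Polynomial.aeval s P) (hlt : Z.order + S.order < e) :
    ∃ i, Odd i ∧ P.coeff i ≠ 0 := by
  refine exists_odd_coeff_ne_zero_of_order_derivative_lt he hZ (lt_of_le_of_lt ?_ hlt)
  rw [← order_mul, hZS, order_mul]
  exact le_add_self

end CharTwo

end Summit.BirchSwinnertonDyer.BirchSwinnertonDyer.Theorems.SignedMuAtTwo.Tilt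

end
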